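import Literature.AnabelianGeometry.AbsoluteAnabelian.GaloisCyclotomeDirected
import HarnessLib

/-!
# [AbsTopIII] Cor. 1.10 (i)(a): `μ_{ℚ/ℤ}(G)` is unaffected by passing to an open subgroup

Mochizuki, *Topics in Absolute Anabelian Geometry III*, §1, Cor. 1.10 (i)(a), manuscript p. 42 (lit key
`paper:url-5493eb38cbb7`), the bracketed remark after the definition
`μ_{ℚ/ℤ}(G_k) := lim_{→ H} (H^ab)_tors`: "[Thus, the underlying module of `μ_{ℚ/ℤ}(G_k)`, `μ_Ẑ(G_k)` is
unaffected by the operation of passing from `G_k` to an open subgroup of `G_k`.]" — and, on the same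
page, "the asserted 'functoriality' is with respect to arbitrary injective OPEN homomorphisms of
profinite groups" (an injective open homomorphism is an isomorphism onto an open subgroup; the
isomorphism half is abc-iut-L4-t1's `GaloisCyclotomeFunctoriality.lean`, the open-subgroup half is
this file).

For an open subgroup `H` of a compact group `G` (the REAL `μ_{ℚ/ℤ}` of `GaloisCyclotome.lean`,
abc-iut-L4-t1; its directedness `GaloisCyclotomeDirected.lean` and the transitivity of the transfer
`GroupTheory/Transfer/TransferTransitivity.lean`, abc-iut-L4-t17):
* `osMap H U'` / `osComap H U` / `osEquiv H U'` — open subgroups of `H` as open subgroups of `G` inside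
  `H`, and the topological group isomorphism `U' ≃ₜ* osMap H U'`;
* `topAbelianizationCongr`, `torsionCongr` — transport of `(−)^ab` and `(−)_tors` along isomorphisms;
* `verlagerung_osEquiv` — the Verlagerung of `V' ≤ U'` computed in `H` IS the Verlagerung of their
  images computed in `G` (the transfer only sees the groups and the inclusion:
  `transfer_apply_mulEquiv`);
* `muQZ.restrictOpen H : μ_{ℚ/ℤ}(H) →+ μ_{ℚ/ℤ}(G)` (direct-limit lift of the structure maps of the images),
  `muQZ.restrictOpen_of`, and **`muQZ.restrictOpenEquiv H : μ_{ℚ/ℤ}(H) ≃+ μ_{ℚ/ℤ}(G)`** — surjective by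
  COFINALITY (`U ↦ U ∩ H`, `muQZ.of_verlagerung`), injective by EXACTNESS of the directed limit
  (`muQZ.of_eq_zero_iff`, which is where transitivity of the Verlagerung enters); and
  **`muZhat.restrictOpenEquiv H : μ_Ẑ(H) ≃* μ_Ẑ(G)`** (transport by `EtaleTheta.cyclotome.map`).

Not here: the `G`- and `H`-equivariance of the comparison (needs the conjugation action,
`GaloisCyclotomeAction.lean`, abc-iut-L4-t1) and the index factor for NON-bijective open injections on
`μ_Ẑ` vs. `H²` (Rmk. 1.10.1 (i) p. 44).  Topological group theory only; nothing here bears on the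
disputed parts of IUT.
-/

noncomputable section

open scoped Pointwise

universe u

namespace Literature.AnabelianGeometry.AbsoluteAnabelian

open Literature.GroupTheory.Transfer Topology

/-! ### Transport of topological abelianizations and their torsion along isomorphisms -/

section Transport

variable {A : Type u} [Group A] [TopologicalSpace A] [IsTopologicalGroup A]
  {B : Type u} [Group B] [TopologicalSpace B] [IsTopologicalGroup B]

/-- A topological group isomorphism maps the closure of the commutator subgroup onto the closure of
the commutator subgroup. [cite: MochizukiAbsTopIII2015, Cor 1.10 (i) p.42] -/
theorem topClosure_commutator_map_equiv (e : A ≃ₜ* B) :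
    (commutator A).topologicalClosure.map (e.toMulEquiv : A →* B) =
      (commutator B).topologicalClosure := by
  apply SetLike.coe_injective
  rw [Subgroup.coe_map, Subgroup.topologicalClosure_coe, Subgroup.topologicalClosure_coe]
  have hcomm : (commutator A).map (e.toMulEquiv : A →* B) = commutator B := by
    rw [commutator_def, commutator_def, Subgroup.map_commutator,
      Subgroup.map_top_of_surjective _ e.surjective]
  have h1 : ((e.toMulEquiv : A →* B) : A → B) = (e.toHomeomorph : A → B) := rfl
  rw [h1, e.toHomeomorph.image_closure, ← hcomm, Subgroup.coe_map, h1]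

/-- Transport of topological abelianizations `A^ab ≃* B^ab` along a topological group isomorphism
`A ≃ₜ* B`. [cite: MochizukiAbsTopIII2015, Cor 1.10 (i) p.42] -/
def topAbelianizationCongr (e : A ≃ₜ* B) :
    TopologicalAbelianization A ≃* TopologicalAbelianization B :=
  QuotientGroup.congr _ _ e.toMulEquiv (topClosure_commutator_map_equiv e)

/-- `topAbelianizationCongr` on classes. [cite: MochizukiAbsTopIII2015, Cor 1.10 (i) p.42] -/
@[simp] theorem topAbelianizationCongr_mk (e : A ≃ₜ* B) (a : A) :
    topAbelianizationCongr e (QuotientGroup.mk a) = QuotientGroup.mk (e a) :=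
  rfl

/-- An isomorphism of abelian groups restricts to an isomorphism of torsion subgroups.
[cite: MochizukiAbsTopIII2015, Cor 1.10 (i) p.42] -/
def torsionCongr {C D : Type u} [CommGroup C] [CommGroup D] (e : C ≃* D) :
    CommGroup.torsion C ≃* CommGroup.torsion D where
  toFun x := ⟨e (x : C), (CommGroup.mem_torsion _).mpr
    (e.toMonoidHom.isOfFinOrder ((CommGroup.mem_torsion _).mp x.2))⟩
  invFun y := ⟨e.symm (y : D), (CommGroup.mem_torsion _).mpr
    (e.symm.toMonoidHom.isOfFinOrder ((CommGroup.mem_torsion _).mp y.2))⟩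
  left_inv x := Subtype.ext (e.symm_apply_apply (x : C))
  right_inv y := Subtype.ext (e.apply_symm_apply (y : D))
  map_mul' x y := Subtype.ext (map_mul e (x : C) (y : C))

/-- Underlying formula for `torsionCongr`. [cite: MochizukiAbsTopIII2015, Cor 1.10 (i) p.42] -/
@[simp] theorem coe_torsionCongr {C D : Type u} [CommGroup C] [CommGroup D] (e : C ≃* D)
    (x : CommGroup.torsion C) : (torsionCongr e x : D) = e (x : C) :=
  rfl

end Transport

/-! ### Open subgroups of an open subgroup -/

section OpenSub

variable {G : Type u} [Group G] [TopologicalSpace G]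

/-- An open subgroup of a compact group is compact. [cite: MochizukiAbsTopIII2015, Cor 1.10 (i) p.42] -/
instance OpenSubgroup.instCompactSpaceSubtypeMem [ContinuousMul G] [CompactSpace G]
    (H : OpenSubgroup G) : CompactSpace (H : Subgroup G) :=
  isCompact_iff_compactSpace.mp H.isClosed.isCompact

/-- An open subgroup `U'` of the open subgroup `H` of `G`, as an open subgroup of `G` (its image
under the open embedding `H ↪ G`). [cite: MochizukiAbsTopIII2015, Cor 1.10 (i) p.42] -/
def osMap (H : OpenSubgroup G) (U' : OpenSubgroup (H : Subgroup G)) : OpenSubgroup G :=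
  ⟨(U' : Subgroup (H : Subgroup G)).map (H : Subgroup G).subtype,
    H.isOpen.isOpenEmbedding_subtypeVal.isOpenMap _ U'.isOpen⟩

/-- `osMap` as a subgroup of `G`. [cite: MochizukiAbsTopIII2015, Cor 1.10 (i) p.42] -/
@[simp] theorem coe_osMap (H : OpenSubgroup G) (U' : OpenSubgroup (H : Subgroup G)) :
    (osMap H U' : Subgroup G) = (U' : Subgroup (H : Subgroup G)).map (H : Subgroup G).subtype := rfl

/-- Membership in `osMap H U'`. [cite: MochizukiAbsTopIII2015, Cor 1.10 (i) p.42] -/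
theorem mem_osMap_iff (H : OpenSubgroup G) (U' : OpenSubgroup (H : Subgroup G)) {g : G} :
    g ∈ osMap H U' ↔ ∃ h : g ∈ H, (⟨g, h⟩ : (H : Subgroup G)) ∈ U' := by
  change g ∈ (U' : Subgroup (H : Subgroup G)).map (H : Subgroup G).subtype ↔ _
  rw [Subgroup.mem_map]
  constructor
  · rintro ⟨x, hx, rfl⟩
    exact ⟨x.2, by simpa using hx⟩
  · rintro ⟨h, hx⟩
    exact ⟨⟨g, h⟩, hx, rfl⟩

/-- An element of `H` lies in `osMap H U'` iff it lies in `U'`. [cite: MochizukiAbsTopIII2015, Cor 1.10 (i) p.42] -/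
theorem coe_mem_osMap_iff (H : OpenSubgroup G) (U' : OpenSubgroup (H : Subgroup G)) (x : (H : Subgroup G)) :
    (x : G) ∈ osMap H U' ↔ x ∈ U' := by
  rw [mem_osMap_iff]
  exact ⟨fun ⟨_, hx⟩ => hx, fun hx => ⟨x.2, hx⟩⟩

/-- `osMap H U' ≤ H`. [cite: MochizukiAbsTopIII2015, Cor 1.10 (i) p.42] -/
theorem osMap_le (H : OpenSubgroup G) (U' : OpenSubgroup (H : Subgroup G)) :
    (osMap H U' : Subgroup G) ≤ H := fun _ hg =>
  ((mem_osMap_iff H U').mp hg).1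

/-- `osMap H` is monotone. [cite: MochizukiAbsTopIII2015, Cor 1.10 (i) p.42] -/
theorem osMap_mono (H : OpenSubgroup G) {U' V' : OpenSubgroup (H : Subgroup G)} (h : V' ≤ U') :
    osMap H V' ≤ osMap H U' := fun _ hg => by
  obtain ⟨hH, hx⟩ := (mem_osMap_iff H V').mp hg
  exact (mem_osMap_iff H U').mpr ⟨hH, h hx⟩

/-- An open subgroup of `G` contained in `H`, as an open subgroup of `H`.
[cite: MochizukiAbsTopIII2015, Cor 1.10 (i) p.42] -/
def osComap (H : OpenSubgroup G) (U : OpenSubgroup G) : OpenSubgroup (H : Subgroup G) :=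
  U.comap (H : Subgroup G).subtype continuous_subtype_val

/-- Membership in `osComap H U`. [cite: MochizukiAbsTopIII2015, Cor 1.10 (i) p.42] -/
@[simp] theorem mem_osComap_iff (H : OpenSubgroup G) (U : OpenSubgroup G) (x : (H : Subgroup G)) :
    x ∈ osComap H U ↔ (x : G) ∈ U := Iff.rfl

/-- An open subgroup of `G` inside `H` is the image of its trace on `H` (cofinality of the open
subgroups coming from `H`). [cite: MochizukiAbsTopIII2015, Cor 1.10 (i) p.42] -/
theorem osMap_osComap (H : OpenSubgroup G) {U : OpenSubgroup G}
    (hU : (U : Subgroup G) ≤ H) : osMap H (osComap H U) = U := by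
  ext g
  rw [mem_osMap_iff]
  constructor
  · rintro ⟨_, hx⟩; exact hx
  · intro hg; exact ⟨hU hg, hg⟩

/-- The topological group isomorphism `U' ≃ₜ* U'†` between an open subgroup of `H` and its image in
`G`. [cite: MochizukiAbsTopIII2015, Cor 1.10 (i) p.42] -/
def osEquiv (H : OpenSubgroup G) (U' : OpenSubgroup (H : Subgroup G)) :
    ((U' : Subgroup (H : Subgroup G)) : Type u) ≃ₜ* ((osMap H U' : Subgroup G) : Type u) where
  toFun x := ⟨((x : (H : Subgroup G)) : G), (coe_mem_osMap_iff H U' x).mpr x.2⟩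
  invFun y := ⟨⟨(y : G), osMap_le H U' y.2⟩,
    (coe_mem_osMap_iff H U' ⟨(y : G), osMap_le H U' y.2⟩).mp y.2⟩
  left_inv x := rfl
  right_inv y := rfl
  map_mul' x y := rfl
  continuous_toFun := by
    apply Continuous.subtype_mk
    exact continuous_subtype_val.comp continuous_subtype_val
  continuous_invFun := by
    apply Continuous.subtype_mk
    apply Continuous.subtype_mk
    exact continuous_subtype_val

/-- Underlying formula for `osEquiv`. [cite: MochizukiAbsTopIII2015, Cor 1.10 (i) p.42] -/
@[simp] theorem coe_osEquiv (H : OpenSubgroup G) (U' : OpenSubgroup (H : Subgroup G))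
    (x : (U' : Subgroup (H : Subgroup G))) :
    ((osEquiv H U' x : (osMap H U' : Subgroup G)) : G) = ((x : (H : Subgroup G)) : G) := rfl


end OpenSub


/-! ### The Verlagerung of `H`'s open subgroups is the Verlagerung of their images in `G` -/

section Compare

variable {G : Type u} [Group G] [TopologicalSpace G] [IsTopologicalGroup G] [CompactSpace G]
  (H : OpenSubgroup G)

/-- Transport of the Verlagerung along `U' ≃ₜ* U'†`: for open `V' ≤ U'` in `H`,
`Ver_{U'†,V'†} ∘ (U'^ab ≅ U'†^ab) = (V'^ab ≅ V'†^ab) ∘ Ver_{U',V'}` (the transfer only sees the groups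
`U' ≅ U'†` and the inclusion; `transfer_apply_mulEquiv`). [cite: MochizukiAbsTopIII2015, Cor 1.10 (i) p.42] -/
theorem verlagerung_osEquiv {U' V' : OpenSubgroup (H : Subgroup G)} (h : V' ≤ U')
    (x : TopologicalAbelianization ((U' : Subgroup (H : Subgroup G)) : Type u)) :
    topAbelianizationCongr (osEquiv H V')
        (verlagerung U'.isOpen V'.isOpen (OpenSubgroup.toSubgroup_le.mpr h) x) =
      verlagerung (osMap H U').isOpen (osMap H V').isOpen
        (OpenSubgroup.toSubgroup_le.mpr (osMap_mono H h))
        (topAbelianizationCongr (osEquiv H U') x) := by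
  haveI := finiteIndex_subgroupOf U'.isOpen V'.isOpen (U := (U' : Subgroup (H : Subgroup G)))
    (V := (V' : Subgroup (H : Subgroup G)))
  haveI := finiteIndex_subgroupOf (osMap H U').isOpen (osMap H V').isOpen
    (U := (osMap H U' : Subgroup G)) (V := (osMap H V' : Subgroup G))
  induction x using QuotientGroup.induction_on with
  | H u =>
    rw [verlagerung_mk, topAbelianizationCongr_mk, verlagerung_mk]
    unfold transferToAbelianization
    rw [← MulEquiv.coe_toMonoidHom, ← MonoidHom.comp_apply, ← transfer_comp]
    have h2 := transfer_apply_mulEquiv (osEquiv H U').toMulEquiv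
      (H := (osMap H V' : Subgroup G).subgroupOf (osMap H U' : Subgroup G))
      (H' := (V' : Subgroup (H : Subgroup G)).subgroupOf (U' : Subgroup (H : Subgroup G))) (fun z => by
        simp only [Subgroup.mem_subgroupOf]
        exact (coe_mem_osMap_iff H V' (z : (H : Subgroup G))).symm)
      (toAbelianizationOfLe (OpenSubgroup.toSubgroup_le.mpr (osMap_mono H h))) u
    rw [show ((osEquiv H U').toMulEquiv : _ → _) u = osEquiv H U' u from rfl] at h2
    rw [h2]
    congr 1

/-- The same on torsion subgroups. [cite: MochizukiAbsTopIII2015, Cor 1.10 (i) p.42] -/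
theorem torsionCongr_verlagerungTorsion {U' V' : OpenSubgroup (H : Subgroup G)} (h : V' ≤ U')
    (x : abelianizationTorsion (U' : Subgroup (H : Subgroup G))) :
    torsionCongr (topAbelianizationCongr (osEquiv H V'))
        (verlagerungTorsion U'.isOpen V'.isOpen (OpenSubgroup.toSubgroup_le.mpr h) x) =
      verlagerungTorsion (osMap H U').isOpen (osMap H V').isOpen
        (OpenSubgroup.toSubgroup_le.mpr (osMap_mono H h))
        (torsionCongr (topAbelianizationCongr (osEquiv H U')) x) :=
  Subtype.ext (verlagerung_osEquiv H h x)

/-! ### `μ_{ℚ/ℤ}(H) ≅ μ_{ℚ/ℤ}(G)` for an open subgroup `H` -/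

/-- The component `(U'^ab)_tors ≅ (U'†^ab)_tors → μ_{ℚ/ℤ}(G)` of the comparison map.
[cite: MochizukiAbsTopIII2015, Cor 1.10 (i) p.42] -/
def muQZ.restrictOpenComponent (U' : OpenSubgroup (H : Subgroup G)) :
    Additive (abelianizationTorsion (U' : Subgroup (H : Subgroup G))) →+ muQZ G :=
  (muQZ.of (osMap H U')).comp
    (MonoidHom.toAdditive (torsionCongr (topAbelianizationCongr (osEquiv H U'))).toMonoidHom)

/-- Formula for the component. [cite: MochizukiAbsTopIII2015, Cor 1.10 (i) p.42] -/
theorem muQZ.restrictOpenComponent_apply (U' : OpenSubgroup (H : Subgroup G))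
    (x : abelianizationTorsion (U' : Subgroup (H : Subgroup G))) :
    muQZ.restrictOpenComponent H U' (Additive.ofMul x) =
      muQZ.of (osMap H U') (Additive.ofMul (torsionCongr (topAbelianizationCongr (osEquiv H U')) x)) :=
  rfl

open scoped Classical in
/-- **The comparison map `μ_{ℚ/ℤ}(H) → μ_{ℚ/ℤ}(G)`** for an open subgroup `H` of a compact group `G`
("the underlying module of `μ_{ℚ/ℤ}(G_k)` is unaffected by the operation of passing from `G_k` to an
open subgroup", [AbsTopIII] Cor. 1.10 (i)(a) p. 42): on `(U'^ab)_tors`, `U'` open in `H`, it is the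
structure map of the image `U'† ⊆ G`. [cite: MochizukiAbsTopIII2015, Cor 1.10 (i) p.42] -/
def muQZ.restrictOpen : muQZ (H : Subgroup G) →+ muQZ G :=
  AddCommGroup.DirectLimit.lift _ _ _ (fun U' => muQZ.restrictOpenComponent H (OrderDual.ofDual U'))
    (fun i j hij x => by
      obtain ⟨x, rfl⟩ := Additive.ofMul.surjective x
      change muQZ.restrictOpenComponent H (OrderDual.ofDual j) (Additive.ofMul
          (verlagerungTorsion (OrderDual.ofDual i).isOpen (OrderDual.ofDual j).isOpen _ x)) =
        muQZ.restrictOpenComponent H (OrderDual.ofDual i) (Additive.ofMul x)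
      rw [muQZ.restrictOpenComponent_apply, muQZ.restrictOpenComponent_apply,
        torsionCongr_verlagerungTorsion H (OrderDual.ofDual_le_ofDual.mpr hij) x,
        muQZ.of_verlagerung]
      exact osMap_mono H (OrderDual.ofDual_le_ofDual.mpr hij))

open scoped Classical in
/-- The comparison map on structure maps: `(U'^ab)_tors → μ_{ℚ/ℤ}(H) → μ_{ℚ/ℤ}(G)` is
`(U'^ab)_tors ≅ (U'†^ab)_tors → μ_{ℚ/ℤ}(G)`. [cite: MochizukiAbsTopIII2015, Cor 1.10 (i) p.42] -/
@[simp] theorem muQZ.restrictOpen_of (U' : OpenSubgroup (H : Subgroup G))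
    (x : abelianizationTorsion (U' : Subgroup (H : Subgroup G))) :
    muQZ.restrictOpen H (muQZ.of U' (Additive.ofMul x)) =
      muQZ.of (osMap H U') (Additive.ofMul (torsionCongr (topAbelianizationCongr (osEquiv H U')) x)) :=
  AddCommGroup.DirectLimit.lift_of _ _ _ _ _

open scoped Classical in
/-- Surjectivity of `μ_{ℚ/ℤ}(H) → μ_{ℚ/ℤ}(G)`: the open subgroups of `G` inside `H` are cofinal
(`U ↦ U ∩ H`, `muQZ.of_verlagerung`). [cite: MochizukiAbsTopIII2015, Cor 1.10 (i) p.42] -/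
theorem muQZ.restrictOpen_surjective : Function.Surjective (muQZ.restrictOpen H) := by
  -- every structure map of an open subgroup INSIDE `H` is in the range
  have key : ∀ (U : OpenSubgroup G), (U : Subgroup G) ≤ H →
      ∀ y : abelianizationTorsion (U : Subgroup G),
        muQZ.of U (Additive.ofMul y) ∈ Set.range (muQZ.restrictOpen H) := by
    intro U hU y
    obtain ⟨U', rfl⟩ : ∃ U', U = osMap H U' := ⟨osComap H U, (osMap_osComap H hU).symm⟩
    refine ⟨muQZ.of U' (Additive.ofMul
      ((torsionCongr (topAbelianizationCongr (osEquiv H U'))).symm y)), ?_⟩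
    rw [muQZ.restrictOpen_of, MulEquiv.apply_symm_apply]
  intro z
  obtain ⟨U, x, rfl⟩ := muQZ.exists_of z
  have h : U ⊓ H ≤ U := inf_le_left
  rw [← muQZ.of_verlagerung h x]
  exact key (U ⊓ H) (OpenSubgroup.toSubgroup_le.mpr inf_le_right) _

open scoped Classical in
/-- Injectivity of `μ_{ℚ/ℤ}(H) → μ_{ℚ/ℤ}(G)`: exactness of the direct limit (`muQZ.of_eq_zero_iff`,
which needs the Verlagerung system to be DIRECTED) on both sides, and transport of the Verlagerung.
[cite: MochizukiAbsTopIII2015, Cor 1.10 (i) p.42] -/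
theorem muQZ.restrictOpen_injective : Function.Injective (muQZ.restrictOpen H) := by
  rw [injective_iff_map_eq_zero]
  intro z hz
  obtain ⟨U', x, rfl⟩ := muQZ.exists_of z
  rw [muQZ.restrictOpen_of, muQZ.of_eq_zero_iff] at hz
  obtain ⟨V, hV, h1⟩ := hz
  have hVH : (V : Subgroup G) ≤ H := (OpenSubgroup.toSubgroup_le.mpr hV).trans (osMap_le H U')
  obtain ⟨V', rfl⟩ : ∃ V', V = osMap H V' := ⟨osComap H V, (osMap_osComap H hVH).symm⟩
  have hV' : V' ≤ U' := fun y hy =>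
    (coe_mem_osMap_iff H U' y).mp (hV ((coe_mem_osMap_iff H V' y).mpr hy))
  have h2 : verlagerungTorsion U'.isOpen V'.isOpen (OpenSubgroup.toSubgroup_le.mpr hV') x = 1 := by
    apply (torsionCongr (topAbelianizationCongr (osEquiv H V'))).injective
    rw [torsionCongr_verlagerungTorsion H hV' x, map_one]
    exact h1
  rw [← muQZ.of_verlagerung hV' x, h2]
  simp

open scoped Classical in
/-- **`μ_{ℚ/ℤ}(H) ≃ μ_{ℚ/ℤ}(G)` for an open subgroup `H` of a compact group `G`** ([AbsTopIII]
Cor. 1.10 (i)(a) p. 42: "the underlying module of `μ_{ℚ/ℤ}(G_k)`, `μ_Ẑ(G_k)` is unaffected by the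
operation of passing from `G_k` to an open subgroup of `G_k`"). [cite: MochizukiAbsTopIII2015, Cor 1.10 (i) p.42] -/
def muQZ.restrictOpenEquiv : muQZ (H : Subgroup G) ≃+ muQZ G :=
  AddEquiv.ofBijective (muQZ.restrictOpen H)
    ⟨muQZ.restrictOpen_injective H, muQZ.restrictOpen_surjective H⟩

open scoped Classical in
/-- `muQZ.restrictOpenEquiv` is `muQZ.restrictOpen`. [cite: MochizukiAbsTopIII2015, Cor 1.10 (i) p.42] -/
theorem muQZ.restrictOpenEquiv_apply (z : muQZ (H : Subgroup G)) :
    muQZ.restrictOpenEquiv H z = muQZ.restrictOpen H z := rfl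

/-! ### `μ_Ẑ(H) ≅ μ_Ẑ(G)` -/

/-- **`μ_Ẑ(H) ≃ μ_Ẑ(G)` for an open subgroup `H` of a compact group `G`** ("the underlying module of
`μ_{ℚ/ℤ}(G_k)`, `μ_Ẑ(G_k)` is unaffected by the operation of passing from `G_k` to an open subgroup",
[AbsTopIII] Cor. 1.10 (i)(a) p. 42): `μ_Ẑ = Hom(ℚ/ℤ, μ_{ℚ/ℤ})` realised as `EtaleTheta.cyclotome`, transported
along `muQZ.restrictOpenEquiv` by `cyclotome.map`. [cite: MochizukiAbsTopIII2015, Cor 1.10 (i) p.42] -/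
def muZhat.restrictOpenEquiv : muZhat (H : Subgroup G) ≃* muZhat G where
  toFun := EtaleTheta.cyclotome.map
    (AddMonoidHom.toMultiplicative (muQZ.restrictOpenEquiv H).toAddMonoidHom)
  invFun := EtaleTheta.cyclotome.map
    (AddMonoidHom.toMultiplicative (muQZ.restrictOpenEquiv H).symm.toAddMonoidHom)
  left_inv ζ := Subtype.ext (funext fun n => by
    change Multiplicative.ofAdd ((muQZ.restrictOpenEquiv H).symm (Multiplicative.toAdd
      (Multiplicative.ofAdd ((muQZ.restrictOpenEquiv H)
        (Multiplicative.toAdd ((ζ : ℕ+ → Multiplicative (muQZ (H : Subgroup G))) n)))))) = _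
    rw [toAdd_ofAdd, AddEquiv.symm_apply_apply, ofAdd_toAdd])
  right_inv ζ := Subtype.ext (funext fun n => by
    change Multiplicative.ofAdd ((muQZ.restrictOpenEquiv H) (Multiplicative.toAdd
      (Multiplicative.ofAdd ((muQZ.restrictOpenEquiv H).symm
        (Multiplicative.toAdd ((ζ : ℕ+ → Multiplicative (muQZ G)) n)))))) = _
    rw [toAdd_ofAdd, AddEquiv.apply_symm_apply, ofAdd_toAdd])
  map_mul' ζ ξ := map_mul _ ζ ξ

/-- Components of `muZhat.restrictOpenEquiv`: apply `muQZ.restrictOpen` (read multiplicatively).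
[cite: MochizukiAbsTopIII2015, Cor 1.10 (i) p.42] -/
@[simp] theorem muZhat.coe_restrictOpenEquiv_apply (ζ : muZhat (H : Subgroup G)) (n : ℕ+) :
    ((muZhat.restrictOpenEquiv H ζ : muZhat G) : ℕ+ → Multiplicative (muQZ G)) n =
      Multiplicative.ofAdd (muQZ.restrictOpen H (Multiplicative.toAdd ((ζ : ℕ+ → _) n))) := rfl

end Compare

end Literature.AnabelianGeometry.AbsoluteAnabelian
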